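import Summits.CriticalPhenomena.Ising3DConformalLimit.Theorems.CoerciveSharpnessPhiCoerciveSplit
import Literature.Probability.LatticeModels.SharpLengthCorrLength
import Literature.Probability.LatticeModels.CriticalTwoPointBounds
import Literature.Probability.LatticeModels.SharpnessDecayProofs

/-!
# Negative lemmas for the crux `CoerciveSharpness.PhiCoercive` (stmt-CriticalPhenomena-18196): load-bearing hypotheses and tightness

Crux disprover `refuter-cdisprove-stmt-CriticalPhenomena-18196-0`, route `CoerciveSharpness`,
sub-problem `CriticalPhenomena/Ising3DConformalLimit`.  Companion of the crux work file
`Cruxes/PhiCoercive/Disproof.lean` (which imports this module).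

The crux (`PhiCoercive`, = `∃ κ c > 0, ∀ m ≥ 1, ∀ finite S ⊇ Λ_m, c·m^κ ≤ φ_{β_c(3)}(S)` with
`φ_β(S) = β Σ_{x∈S} #{y ∉ S : y ∼ x} ⟨σ₀σ_x⟩^free_{S,β}` the Duminil-Copin–Panis sharpness functional,
`phiC S = dcpPhi 3 (criticalBeta 3) S`) is an open-problem-level GROWTH statement (`κ = 1 − η_⊥ ≈ 0.21`
predicted; `κ = 0` is a theorem, `BoxSuperset.one_le_phiC`).  Nothing here asserts a Theses decl.  What is
proved (sorry-free, axioms `propext`/`Classical.choice`/`Quot.sound`):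

* `phiC_box_le_linear` — **tightness of the exponent range**: `φ_{β_c}(Λ_m) ≤ A·m` for all `m ≥ 1`
  (Def. 1.1 on a box, `dcpPhi_box_succ_le`, + the infrared bound at `β_c`, `twoPointFree_criticalBeta_upper_holds`,
  + the shell count `card_sphere_succ_le`, inlined; the same count is `card_sphere_three_le` of another route's helper).  Hence
* `not_boxCoercive_exponent_gt_one`, `not_phiCoercive_exponent_gt_one` — the NATURAL STRENGTHENING of the
  crux to an exponent `κ > 1` is FALSE: any proof must produce `κ ∈ (0, 1]` (physically `κ ≈ 0.21`; excluding
  `κ = 1` would need `η > 0`, open).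
* `phiCoercive_false_subcritical` — **criticality is load-bearing**: for every `0 ≤ β < β_c(3)` the same
  coercivity statement with `β` in place of `β_c(3)` is FALSE, because `φ_β(Λ_{k+1}) ≤ 6β·54(k+1)²·e^{-c(k+1)} → 0`
  (Aizenman–Barsky–Fernández / Duminil-Copin–Tassion sharpness, `twoPoint_exponentialDecay_of_lt_criticalBeta_holds`).
  So no argument that is continuous/monotone in `β` from below can give the crux: the input must live AT `β_c`.
* `phiCoercive_false_without_box` — **the shape anchor `Λ_m ⊆ S` is load-bearing**: weakening it to the
  Duminil-Copin–Tassion condition `0 ∈ S` makes the statement FALSE (`S = {0}`: `φ_{β_c}({0}) = 6β_c(3)` for every `m`,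
  `dcpPhi_singleton_zero`).  (The anchor cannot be weakened to "`S ∋ 0` large" either — thin sets radiate `O(1)` —
  but the singleton already kills the unanchored form.)

Informal companions (not provable in Lean today, recorded in `Disproof.lean`): `κ = 0` exactly for the Gaussian
walk (`φ^{RW} ≡ 1`), so the dimension `d = 3`/the interaction is load-bearing too (barrier
`IsingTrivialityFromDimensionFour`); 2-D exact transfer-matrix scan of adversarial supersets (kit job j026052).
-/

noncomputable section

namespace Summit.CriticalPhenomena.Ising3DConformalLimit.Cruxes.PhiCoercive.Negative

open scoped BigOperators Topology
open Finset Filter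
open Literature.Probability.LatticeModels
open Summit.CriticalPhenomena.Ising3DConformalLimit.Theses.CoerciveSharpness (PhiCoercive)
open Summit.CriticalPhenomena.Ising3DConformalLimit.Cruxes.PhiCoercive.BoxSuperset (phiC phiC_eq_dcpPhi
  BoxCoercive)

/-! ## 1. Tightness: the box flux is at most linear, so `κ ≤ 1` -/

/-- On the sphere `∂Λ_{k+1}` the sup norm is `k + 1`. -/
theorem norm_eq_of_mem_sphere_succ {k : ℕ} {x : Site 3} (hx : x ∈ sphere 3 (k + 1)) :
    ‖x‖ = (k : ℝ) + 1 := by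
  rw [Site.norm_eq_supNorm, mem_sphere.1 hx]; push_cast; ring

/-- **`φ_{β_c(3)}(Λ_m) ≤ A·m` for all `m ≥ 1`** (Duminil-Copin–Panis Def. 1.1 on a box: each of the
`≤ 54 m²` boundary sites has `≤ 6` outer neighbours and, by GKS and the infrared bound at `β_c`,
`⟨σ₀σ_x⟩^free_{Λ_m} ≤ ⟨σ₀σ_x⟩^free_{β_c} ≤ C/m`).  The upper end of the exponent-gap ledger for this crux:
rigorously `1 ≤ φ_{β_c}(Λ_m) ≤ A m`, truth `≍ m^{0.21}`. -/
theorem phiC_box_le_linear : ∃ A : ℝ, 0 < A ∧ ∀ m : ℕ, 1 ≤ m → phiC (box 3 m) ≤ A * m := by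
  obtain ⟨C, hC⟩ := twoPointFree_criticalBeta_upper_holds (d := 3) le_rfl
  have hβ : 0 ≤ criticalBeta 3 := criticalBeta_nonneg 3
  refine ⟨criticalBeta 3 * 6 * 54 * max C 0 + 1, by positivity, fun m hm => ?_⟩
  obtain ⟨k, rfl⟩ : ∃ k, m = k + 1 := ⟨m - 1, by omega⟩
  have hk1 : (0 : ℝ) < (k : ℝ) + 1 := by positivity
  have h1 : phiC (box 3 (k + 1)) ≤
      criticalBeta 3 * (2 * ((3 : ℕ) : ℝ)) * ∑ x ∈ sphere 3 (k + 1), twoPointFree 3 (criticalBeta 3) x := by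
    rw [phiC_eq_dcpPhi]; exact dcpPhi_box_succ_le hβ k
  have h2 : ∀ x ∈ sphere 3 (k + 1), twoPointFree 3 (criticalBeta 3) x ≤ max C 0 * ((k : ℝ) + 1)⁻¹ := by
    intro x hx
    have hxn : Site.supNorm x = k + 1 := mem_sphere.1 hx
    have hx0 : x ≠ 0 := by
      rintro rfl
      rw [Site.supNorm_eq_zero_iff.2 rfl] at hxn
      omega
    have hnorm : ‖x‖ = (k : ℝ) + 1 := norm_eq_of_mem_sphere_succ hx
    have hCx := hC x hx0
    have hexp : (‖x‖ : ℝ) ^ (-(((3 : ℕ) : ℝ) - 2)) = ((k : ℝ) + 1)⁻¹ := by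
      rw [hnorm]; norm_num [Real.rpow_neg_one]
    rw [hexp] at hCx
    exact hCx.trans (mul_le_mul_of_nonneg_right (le_max_left _ _) (by positivity))
  have h3 : ∑ x ∈ sphere 3 (k + 1), twoPointFree 3 (criticalBeta 3) x ≤
      54 * ((k : ℝ) + 1) ^ 2 * (max C 0 * ((k : ℝ) + 1)⁻¹) := by
    have hcard54 : (#(sphere 3 (k + 1)) : ℝ) ≤ 54 * ((k : ℝ) + 1) ^ 2 := by
      -- shell count `#∂Λ_{k+1} ≤ 6(2k+3)² ≤ 54(k+1)²` (`card_sphere_succ_le`; cf. `card_sphere_three_le`)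
      have hcard := card_sphere_succ_le (d := 3) k
      norm_num at hcard
      have hk : (0 : ℝ) ≤ k := Nat.cast_nonneg k
      have h9 : (2 * (k : ℝ) + 3) ^ 2 ≤ 9 * ((k : ℝ) + 1) ^ 2 := by nlinarith [hk, sq_nonneg (k : ℝ)]
      nlinarith [hcard, h9]
    calc ∑ x ∈ sphere 3 (k + 1), twoPointFree 3 (criticalBeta 3) x
        ≤ ∑ x ∈ sphere 3 (k + 1), max C 0 * ((k : ℝ) + 1)⁻¹ := Finset.sum_le_sum h2
      _ = (#(sphere 3 (k + 1)) : ℝ) * (max C 0 * ((k : ℝ) + 1)⁻¹) := by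
          rw [Finset.sum_const, nsmul_eq_mul]
      _ ≤ 54 * ((k : ℝ) + 1) ^ 2 * (max C 0 * ((k : ℝ) + 1)⁻¹) :=
          mul_le_mul_of_nonneg_right hcard54 (by positivity)
  have h4 : 54 * ((k : ℝ) + 1) ^ 2 * (max C 0 * ((k : ℝ) + 1)⁻¹) = 54 * max C 0 * ((k : ℝ) + 1) := by
    field_simp
  calc phiC (box 3 (k + 1))
      ≤ criticalBeta 3 * (2 * ((3 : ℕ) : ℝ)) * (54 * ((k : ℝ) + 1) ^ 2 * (max C 0 * ((k : ℝ) + 1)⁻¹)) :=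
        h1.trans (mul_le_mul_of_nonneg_left h3 (by positivity))
    _ = criticalBeta 3 * 6 * 54 * max C 0 * ((k : ℝ) + 1) := by rw [h4]; push_cast; ring
    _ ≤ (criticalBeta 3 * 6 * 54 * max C 0 + 1) * ((k : ℝ) + 1) := by nlinarith [hk1, hβ, le_max_right C 0]
    _ = (criticalBeta 3 * 6 * 54 * max C 0 + 1) * ((k + 1 : ℕ) : ℝ) := by push_cast; ring

/-- **Natural strengthening refuted (boxes): no exponent `κ > 1`.**  `¬ ∃ c > 0, ∀ m ≥ 1, c·m^κ ≤ φ_{β_c}(Λ_m)`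
for every `κ > 1` — the box piece `BoxCoercive` of the crux can only hold with `κ ≤ 1`. -/
theorem not_boxCoercive_exponent_gt_one {κ : ℝ} (hκ : 1 < κ) :
    ¬ ∃ c : ℝ, 0 < c ∧ ∀ m : ℕ, 1 ≤ m → c * (m : ℝ) ^ κ ≤ phiC (box 3 m) := by
  rintro ⟨c, hc, h⟩
  obtain ⟨A, hA, hlin⟩ := phiC_box_le_linear
  have hev : ∀ m : ℕ, 1 ≤ m → c * (m : ℝ) ^ (κ - 1) ≤ A := by
    intro m hm
    have hm' : (0 : ℝ) < m := by exact_mod_cast hm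
    have hle : c * (m : ℝ) ^ κ ≤ A * m := (h m hm).trans (hlin m hm)
    rw [Real.rpow_sub_one hm'.ne', mul_div_assoc', div_le_iff₀ hm']
    exact hle
  have ht : Tendsto (fun m : ℕ => c * (m : ℝ) ^ (κ - 1)) atTop atTop :=
    ((tendsto_rpow_atTop (by linarith)).comp tendsto_natCast_atTop_atTop).const_mul_atTop hc
  obtain ⟨m, hm1, hm2⟩ := ((ht.eventually_gt_atTop A).and (eventually_ge_atTop 1)).exists
  exact absurd (hev m hm2) (not_le.2 hm1)

/-- **Natural strengthening refuted (the crux's own shape): `PhiCoercive` with `1 < κ` in place of `0 < κ` is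
FALSE** (take `S = Λ_m`).  Any proof of the crux must land `κ ∈ (0, 1]`. -/
theorem not_phiCoercive_exponent_gt_one :
    ¬ ∃ κ c : ℝ, 1 < κ ∧ 0 < c ∧ ∀ m : ℕ, 1 ≤ m → ∀ S : Finset (Site 3), box 3 m ⊆ S →
        c * (m : ℝ) ^ κ ≤ phiC S := by
  rintro ⟨κ, c, hκ, hc, h⟩
  exact not_boxCoercive_exponent_gt_one hκ ⟨c, hc, fun m hm => h m hm (box 3 m) subset_rfl⟩

/-! ## 2. Criticality is load-bearing: the subcritical analogue is false -/

/-- Box flux bound from a pointwise bound on the sphere (Def. 1.1 on `Λ_{k+1}`, any `β ≥ 0`):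
if `⟨σ₀σ_x⟩^free_β ≤ g` on `∂Λ_{k+1}` then `φ_β(Λ_{k+1}) ≤ 6β · 54(k+1)² · g`. -/
theorem dcpPhi_box_succ_le_of_sphere_bound {β g : ℝ} (hβ : 0 ≤ β) (k : ℕ)
    (hg : ∀ x ∈ sphere 3 (k + 1), twoPointFree 3 β x ≤ g) (hg0 : 0 ≤ g) :
    dcpPhi 3 β (box 3 (k + 1)) ≤ β * 6 * (54 * ((k : ℝ) + 1) ^ 2 * g) := by
  have h1 := dcpPhi_box_succ_le (d := 3) hβ k
  have h2 : ∑ x ∈ sphere 3 (k + 1), twoPointFree 3 β x ≤ 54 * ((k : ℝ) + 1) ^ 2 * g := by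
    have hcard54 : (#(sphere 3 (k + 1)) : ℝ) ≤ 54 * ((k : ℝ) + 1) ^ 2 := by
      -- shell count `#∂Λ_{k+1} ≤ 6(2k+3)² ≤ 54(k+1)²` (`card_sphere_succ_le`; cf. `card_sphere_three_le`)
      have hcard := card_sphere_succ_le (d := 3) k
      norm_num at hcard
      have hk : (0 : ℝ) ≤ k := Nat.cast_nonneg k
      have h9 : (2 * (k : ℝ) + 3) ^ 2 ≤ 9 * ((k : ℝ) + 1) ^ 2 := by nlinarith [hk, sq_nonneg (k : ℝ)]
      nlinarith [hcard, h9]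
    calc ∑ x ∈ sphere 3 (k + 1), twoPointFree 3 β x ≤ ∑ x ∈ sphere 3 (k + 1), g := Finset.sum_le_sum hg
      _ = (#(sphere 3 (k + 1)) : ℝ) * g := by rw [Finset.sum_const, nsmul_eq_mul]
      _ ≤ 54 * ((k : ℝ) + 1) ^ 2 * g := mul_le_mul_of_nonneg_right hcard54 hg0
  calc dcpPhi 3 β (box 3 (k + 1))
      ≤ β * (2 * ((3 : ℕ) : ℝ)) * ∑ x ∈ sphere 3 (k + 1), twoPointFree 3 β x := h1
    _ ≤ β * (2 * ((3 : ℕ) : ℝ)) * (54 * ((k : ℝ) + 1) ^ 2 * g) :=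
        mul_le_mul_of_nonneg_left h2 (by positivity)
    _ = β * 6 * (54 * ((k : ℝ) + 1) ^ 2 * g) := by push_cast; ring

/-- **Below `β_c(3)` the box flux tends to zero**: for `0 ≤ β < β_c(3)`,
`φ_β(Λ_{k+1}) ≤ 6β·54(k+1)²·e^{-c(k+1)} → 0` (sharpness: `⟨σ₀σ_x⟩^free_β ≤ e^{-c‖x‖}`). -/
theorem dcpPhi_box_eventually_lt_of_lt_criticalBeta {β : ℝ} (hβ : 0 ≤ β) (hβc : β < criticalBeta 3)
    {ε : ℝ} (hε : 0 < ε) : ∀ᶠ k : ℕ in atTop, dcpPhi 3 β (box 3 (k + 1)) < ε := by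
  obtain ⟨c₀, hc₀, hdec⟩ := twoPoint_exponentialDecay_of_lt_criticalBeta_holds (d := 3) (by norm_num) hβ hβc
  have hbound : ∀ k : ℕ, dcpPhi 3 β (box 3 (k + 1)) ≤
      β * 6 * (54 * ((k : ℝ) + 1) ^ 2 * Real.exp (-c₀ * ((k : ℝ) + 1))) := by
    intro k
    refine dcpPhi_box_succ_le_of_sphere_bound hβ k (fun x hx => ?_) (Real.exp_nonneg _)
    have h := hdec x
    rwa [norm_eq_of_mem_sphere_succ hx] at h
  have hy : Tendsto (fun k : ℕ => c₀ * ((k : ℝ) + 1)) atTop atTop :=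
    (tendsto_atTop_add_const_right atTop (1 : ℝ) tendsto_natCast_atTop_atTop).const_mul_atTop hc₀
  have hg : Tendsto (fun k : ℕ => β * 6 * (54 * ((k : ℝ) + 1) ^ 2 * Real.exp (-c₀ * ((k : ℝ) + 1))))
      atTop (𝓝 0) := by
    have h := ((Real.tendsto_pow_mul_exp_neg_atTop_nhds_zero 2).comp hy).const_mul (β * 6 * 54 / c₀ ^ 2)
    rw [mul_zero] at h
    refine h.congr' (Eventually.of_forall fun k => ?_)
    simp only [Function.comp, neg_mul]
    field_simp
  filter_upwards [hg.eventually (gt_mem_nhds hε)] with k hk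
  exact (hbound k).trans_lt hk

/-- **Criticality is load-bearing**: for every `0 ≤ β < β_c(3)` the coercivity statement of the crux with
`β` in place of `β_c(3)` (same `φ`, = `dcpPhi 3 β`, same quantifiers) is FALSE — already on boxes `S = Λ_m`.
So any proof of `PhiCoercive` must use an input that fails strictly below `β_c` (no `β ↑ β_c` continuity /
monotonicity argument from the subcritical side can produce the growth). Non-vacuous: `0 < β_c(3)`
(`criticalBeta_pos_holds`). -/
theorem phiCoercive_false_subcritical {β : ℝ} (hβ : 0 ≤ β) (hβc : β < criticalBeta 3) :
    ¬ ∃ κ c : ℝ, 0 < κ ∧ 0 < c ∧ ∀ m : ℕ, 1 ≤ m → ∀ S : Finset (Site 3), box 3 m ⊆ S →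
        c * (m : ℝ) ^ κ ≤ dcpPhi 3 β S := by
  rintro ⟨κ, c, hκ, hc, h⟩
  obtain ⟨k, hk⟩ := (dcpPhi_box_eventually_lt_of_lt_criticalBeta hβ hβc hc).exists
  have hm : 1 ≤ k + 1 := by omega
  have hle := h (k + 1) hm (box 3 (k + 1)) subset_rfl
  have hpow : (1 : ℝ) ≤ ((k + 1 : ℕ) : ℝ) ^ κ := Real.one_le_rpow (by exact_mod_cast hm) hκ.le
  have hc_le : c ≤ c * ((k + 1 : ℕ) : ℝ) ^ κ := by nlinarith
  linarith

/-- The subcritical range is not empty: `0 < β_c(3)` (Peierls), so e.g. `β = 0` and `β = β_c/2` are instances. -/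
theorem phiCoercive_false_at_zero :
    ¬ ∃ κ c : ℝ, 0 < κ ∧ 0 < c ∧ ∀ m : ℕ, 1 ≤ m → ∀ S : Finset (Site 3), box 3 m ⊆ S →
        c * (m : ℝ) ^ κ ≤ dcpPhi 3 0 S :=
  phiCoercive_false_subcritical le_rfl (criticalBeta_pos_holds (d := 3) (by norm_num))

/-! ## 3. The shape anchor `Λ_m ⊆ S` is load-bearing -/

/-- `φ_{β_c}({0}) = 6 β_c(3)` — a bounded radiator anchored at the origin only. -/
theorem phiC_singleton_zero : phiC {0} = 6 * criticalBeta 3 := by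
  rw [phiC_eq_dcpPhi, dcpPhi_singleton_zero]; push_cast; ring

/-- **The anchor `Λ_m ⊆ S` cannot be weakened to `0 ∈ S`** (the Duminil-Copin–Tassion indexing of `φ_β(S)`):
`¬ ∃ κ c > 0, ∀ m ≥ 1, ∀ finite S ∋ 0, c·m^κ ≤ φ_{β_c}(S)`, witnessed by `S = {0}` for every `m`. -/
theorem phiCoercive_false_without_box :
    ¬ ∃ κ c : ℝ, 0 < κ ∧ 0 < c ∧ ∀ m : ℕ, 1 ≤ m → ∀ S : Finset (Site 3), (0 : Site 3) ∈ S →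
        c * (m : ℝ) ^ κ ≤ phiC S := by
  rintro ⟨κ, c, hκ, hc, h⟩
  have ht : Tendsto (fun m : ℕ => c * (m : ℝ) ^ κ) atTop atTop :=
    ((tendsto_rpow_atTop hκ).comp tendsto_natCast_atTop_atTop).const_mul_atTop hc
  obtain ⟨m, hm1, hm2⟩ := ((ht.eventually_gt_atTop (6 * criticalBeta 3)).and (eventually_ge_atTop 1)).exists
  have hle := h m hm2 {0} (Finset.mem_singleton_self 0)
  rw [phiC_singleton_zero] at hle
  exact absurd hle (not_le.2 hm1)

end Summit.CriticalPhenomena.Ising3DConformalLimit.Cruxes.PhiCoercive.Negative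

end
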